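import Summits.CriticalPhenomena.Ising3DConformalLimit.Theorems.IsingEuclidUpgradeIsingEuclidUpgradeR2RotInvPowerLawVagueKernel
import Summits.CriticalPhenomena.Ising3DConformalLimit.Theorems.IsingEuclidUpgradeIsingEuclidUpgradeR2RotInvPowerLawHelsonLink
import Summits.CriticalPhenomena.Ising3DConformalLimit.Theorems.HarmonicMomentsIsotropyTwoPointAsymptoticIsotropyOfPowerLaw
import Summits.CriticalPhenomena.Ising3DConformalLimit.Theorems.HarmonicMomentsIsotropyTwoPointAsymptoticIsotropyOfWindow
import HarnessLib

/-!
# Crux `IsingEuclidUpgradeR2RotInvPowerLaw` (stmt-CriticalPhenomena-0634) — line `tower_profile_rigidity`,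
# variant V, file 2: VAGUE ISOTROPY REPLACES THE RAY PROFILES

`G := criticalTwoPoint 3`, `g(n) := G(n e₀)`.  The radial atoms of the line are
T1 (dyadic tower law: `g(2^j)(2^j)^{2Δ} → c > 0`), S2 (integer dilation law on the axis:
`g(kn)k^{2Δ}/g(n) → 1`, all `k ≥ 1`), their conjunction D1 (axial pure power law `g(n) n^{2Δ} → c > 0`), and
Sray (the dilation law along every lattice ray).  V is item stmt-CriticalPhenomena-6036
`Theses.HarmonicMomentsIsotropy.TwoPointAsymptoticIsotropy` (vague `O(3)`-asymptotic isotropy).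

THE RESULTS (all sorry-free; T1, S2, V enter as hypotheses only).
* `rayDilationLaw_of_dilationLaw_of_vague` — **S2 ∧ V ⇒ Sray**: the pair limit of file 1
  (`pairLimit_of_dilationLaw_of_vague`) gives ray regular variation (`rayRV_of_pairLimit`), rewritten as Sray
  (`rayLaw_of_rayRV`).  Vague isotropy thus REPLACES the ray-profile stub A_rays of variant P′.
* `IsingEuclidUpgradeR2RotInvPowerLaw_of_towerLaw_of_dilationLaw_of_vague` — **T1 → S2 → V → r2** (TOWER × RAYS
  glue `…_of_towerLaw_of_rayLaw`, p166774).
* `rotInvPowerLaw_iff_towerLaw_and_dilationLaw_and_vague` — **r2 ⟺ T1 ∧ S2 ∧ V** (LOSSLESS: the converses are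
  the landed `towerLaw_of_rotInvPowerLaw`, `dilationLaw_of_rotInvPowerLaw` and
  `twoPointAsymptoticIsotropy_of_rotInvPowerLaw`, file VIII of route HarmonicMomentsIsotropy);
  `rotInvPowerLaw_iff_axisPowerLaw_and_vague` — **r2 ⟺ D1 ∧ V**: the crux is EXACTLY "axial pure power law +
  vague isotropy".
* `IsingEuclidUpgradeR2RotInvPowerLaw_of_towerLaw_of_dilationLaw_of_harmonicDilution_of_window` — with the landed
  engine of route HarmonicMomentsIsotropy (`twoPointAsymptoticIsotropy_of_harmonicDilution_window`:
  items 6034 ∧ 6032 ⇒ 6036): **T1 → S2 → HarmonicDilution → CorrelationLengthWindow → r2**.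
* `axisToIsotropicLaw_of_vague` — **V ⇒ `Theses.HelsonAxis.AxisToIsotropicLaw`** (item stmt-CriticalPhenomena-17971,
  the rank-3 crux of route HelsonAxis, follows from the milestone 6036).
* `IsingEuclidUpgradeR2RotInvPowerLaw_of_axialHelsonCone_of_etaBounds_of_vague` — with the Helson link
  (`axisPowerLaw_of_axialHelsonCone_of_etaBounds`): **items 18121 → 4662 → 6036 → r2**.

Net effect for the planners: item 0634 ⟸ 18121 ∧ 4662 ∧ 6034 ∧ 6032 (four mechanism items of routes HelsonAxis
and HarmonicMomentsIsotropy), and the residue of 0634 proper is PURELY AXIAL (D1 ⟺ T1 ∧ S2).  References: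
H. Duminil-Copin, ICM 2022, §8.1, §8.4 [DuminilCopinICM2022] (rotation invariance and the existence of `η` on `ℤ³`
are open; nothing unconditional is claimed).  No definitions are introduced.
-/

noncomputable section

namespace Summit.CriticalPhenomena.Ising3DConformalLimit.Cruxes.IsingEuclidUpgradeR2RotInvPowerLaw.TowerProfileRigidity

open Literature.Probability.LatticeModels Filter Set
open scoped Topology
open Summit.CriticalPhenomena.Ising3DConformalLimit.MoebiusLimitExistsOnlyInteraction (rhoPin rhoPin_pos)
open Summit.CriticalPhenomena.Ising3DConformalLimit.HarmonicMomentsIsotropyTwoPoint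
open Summit.CriticalPhenomena.Ising3DConformalLimit.HarmonicMomentsIsotropyTwoPoint.RayRV
open Summit.CriticalPhenomena.Ising3DConformalLimit.Theorems.IsingEuclidUpgradeR2Split (axisPowerLaw_of_rotInvPowerLaw)
open Summit.CriticalPhenomena.Ising3DConformalLimit.Theses.HarmonicMomentsIsotropy
open Summit.CriticalPhenomena.Ising3DConformalLimit.Theses

/-! ### S2 ∧ V ⇒ Sray -/

/-- **S2 ∧ V ⇒ ray regular variation** (tree form `G(kmx)/G(mx) → k^{-a}`), through the pair limit of file 1
and `rayRV_of_pairLimit`. [cite: DuminilCopinICM2022, §8.4] -/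
theorem rayRV_of_dilationLaw_of_vague
    (hS2 : ∃ Δ : ℝ, ∀ k : ℕ, 1 ≤ k → Tendsto (fun n : ℕ =>
      criticalTwoPoint 3 (Pi.single 0 ((k * n : ℕ) : ℤ)) * (k : ℝ) ^ (2 * Δ) /
        criticalTwoPoint 3 (Pi.single 0 ((n : ℕ) : ℤ))) atTop (𝓝 1))
    (hV : TwoPointAsymptoticIsotropy) :
    ∃ a : ℝ, ∀ x : Site 3, x ≠ 0 → ∀ k : ℕ, 1 ≤ k →
      Tendsto (fun m : ℕ => criticalTwoPoint 3 (fun i => ((k * m : ℕ) : ℤ) * x i) /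
        criticalTwoPoint 3 (fun i => ((m : ℕ) : ℤ) * x i)) atTop (𝓝 ((k : ℝ) ^ (-a))) := by
  obtain ⟨Δ, hdil⟩ := hS2
  refine rayRV_of_pairLimit ⟨rhoPin, _, rhoPin_pos, pairLimit_of_dilationLaw_of_vague hdil hV, ?_⟩
  intro z hz
  have hinj : Function.Injective z := hz
  have hne : z 0 ≠ z 1 := fun h => absurd (hinj h) (by decide)
  exact Real.rpow_pos_of_pos (norm_pos_iff.2 (sub_ne_zero.2 hne.symm)) _

/-- **S2 ∧ V ⇒ Sray (registered name).** The integer dilation law on the axis and vague asymptotic isotropy give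
the dilation law along EVERY lattice ray with a common exponent: vague isotropy replaces the ray-profile stub
A_rays of the line. [cite: DuminilCopinICM2022, §8.1] -/
theorem rayDilationLaw_of_dilationLaw_of_vague : (∃ Δ : ℝ, ∀ k : ℕ, 1 ≤ k → Filter.Tendsto (fun n : ℕ => Literature.Probability.LatticeModels.criticalTwoPoint 3 (Pi.single 0 ((k * n : ℕ) : ℤ)) * (k : ℝ) ^ (2 * Δ) / Literature.Probability.LatticeModels.criticalTwoPoint 3 (Pi.single 0 ((n : ℕ) : ℤ))) Filter.atTop (nhds 1)) → Summit.CriticalPhenomena.Ising3DConformalLimit.Theses.HarmonicMomentsIsotropy.TwoPointAsymptoticIsotropy → ∃ Δ : ℝ, ∀ v : Literature.Probability.LatticeModels.Site 3, v ≠ 0 → ∀ k : ℕ, 1 ≤ k → Filter.Tendsto (fun n : ℕ => Literature.Probability.LatticeModels.criticalTwoPoint 3 (((k * n : ℕ) : ℤ) • v) * (k : ℝ) ^ (2 * Δ) / Literature.Probability.LatticeModels.criticalTwoPoint 3 (((n : ℕ) : ℤ) • v)) Filter.atTop (nhds 1) :=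
  fun hS2 hV => rayLaw_of_rayRV (rayRV_of_dilationLaw_of_vague hS2 hV)

/-! ### The crux from T1 ∧ S2 ∧ V, and the lossless iff -/

/-- **Variant V glue (registered name): T1 → S2 → V → r2.** [cite: DuminilCopinICM2022, §8.1] -/
theorem IsingEuclidUpgradeR2RotInvPowerLaw_of_towerLaw_of_dilationLaw_of_vague : (∃ Δ c : ℝ, 0 < c ∧ Filter.Tendsto (fun j : ℕ => Literature.Probability.LatticeModels.criticalTwoPoint 3 (Pi.single 0 ((2 ^ j : ℕ) : ℤ)) * ((2 ^ j : ℕ) : ℝ) ^ (2 * Δ)) Filter.atTop (nhds c)) → (∃ Δ : ℝ, ∀ k : ℕ, 1 ≤ k → Filter.Tendsto (fun n : ℕ => Literature.Probability.LatticeModels.criticalTwoPoint 3 (Pi.single 0 ((k * n : ℕ) : ℤ)) * (k : ℝ) ^ (2 * Δ) / Literature.Probability.LatticeModels.criticalTwoPoint 3 (Pi.single 0 ((n : ℕ) : ℤ))) Filter.atTop (nhds 1)) → Summit.CriticalPhenomena.Ising3DConformalLimit.Theses.HarmonicMomentsIsotropy.TwoPointAsymptoticIsotropy → Summit.CriticalPhenomena.Ising3DConformalLimit.Theses.IsingEuclidUpgrade.IsingEuclidUpgradeR2RotInvPowerLaw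 :=
  fun hT hS2 hV => IsingEuclidUpgradeR2RotInvPowerLaw_of_towerLaw_of_rayLaw hT
    (rayDilationLaw_of_dilationLaw_of_vague hS2 hV)

/-- The bet route's copy: the same three hypotheses conclude
`Theses.PrecisionLaplacian.IsingEuclidUpgradeR2RotInvPowerLaw` (item 0634 on route PrecisionLaplacian, the same
proposition). [cite: DuminilCopinICM2022, §8.1] -/
theorem PrecisionLaplacian_IsingEuclidUpgradeR2RotInvPowerLaw_of_towerLaw_of_dilationLaw_of_vague
    (hT : ∃ Δ c : ℝ, 0 < c ∧ Filter.Tendsto (fun j : ℕ => Literature.Probability.LatticeModels.criticalTwoPoint 3 (Pi.single 0 ((2 ^ j : ℕ) : ℤ)) * ((2 ^ j : ℕ) : ℝ) ^ (2 * Δ)) Filter.atTop (nhds c))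
    (hS2 : ∃ Δ : ℝ, ∀ k : ℕ, 1 ≤ k → Filter.Tendsto (fun n : ℕ => Literature.Probability.LatticeModels.criticalTwoPoint 3 (Pi.single 0 ((k * n : ℕ) : ℤ)) * (k : ℝ) ^ (2 * Δ) / Literature.Probability.LatticeModels.criticalTwoPoint 3 (Pi.single 0 ((n : ℕ) : ℤ))) Filter.atTop (nhds 1))
    (hV : TwoPointAsymptoticIsotropy) :
    Summit.CriticalPhenomena.Ising3DConformalLimit.Theses.PrecisionLaplacian.IsingEuclidUpgradeR2RotInvPowerLaw :=
  IsingEuclidUpgradeR2RotInvPowerLaw_of_towerLaw_of_dilationLaw_of_vague hT hS2 hV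

/-- **The crux is EQUIVALENT to T1 ∧ S2 ∧ V (registered name).** Converses: `towerLaw_of_rotInvPowerLaw`,
`dilationLaw_of_rotInvPowerLaw` (landed in the line) and `twoPointAsymptoticIsotropy_of_rotInvPowerLaw` (route
HarmonicMomentsIsotropy, file VIII). [cite: DuminilCopinICM2022, §8.1] -/
theorem rotInvPowerLaw_iff_towerLaw_and_dilationLaw_and_vague : Summit.CriticalPhenomena.Ising3DConformalLimit.Theses.IsingEuclidUpgrade.IsingEuclidUpgradeR2RotInvPowerLaw ↔ ((∃ Δ c : ℝ, 0 < c ∧ Filter.Tendsto (fun j : ℕ => Literature.Probability.LatticeModels.criticalTwoPoint 3 (Pi.single 0 ((2 ^ j : ℕ) : ℤ)) * ((2 ^ j : ℕ) : ℝ) ^ (2 * Δ)) Filter.atTop (nhds c)) ∧ (∃ Δ : ℝ, ∀ k : ℕ, 1 ≤ k → Filter.Tendsto (fun n : ℕ => Literature.Probability.LatticeModels.criticalTwoPoint 3 (Pi.single 0 ((k * n : ℕ) : ℤ)) * (k : ℝ) ^ (2 * Δ) / Literature.Probability.LatticeModels.criticalTwoPoint 3 (Pi.single 0 ((n : ℕ)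 : ℤ))) Filter.atTop (nhds 1)) ∧ Summit.CriticalPhenomena.Ising3DConformalLimit.Theses.HarmonicMomentsIsotropy.TwoPointAsymptoticIsotropy) :=
  ⟨fun h => ⟨towerLaw_of_rotInvPowerLaw h, dilationLaw_of_rotInvPowerLaw h,
      twoPointAsymptoticIsotropy_of_rotInvPowerLaw h⟩,
    fun h => IsingEuclidUpgradeR2RotInvPowerLaw_of_towerLaw_of_dilationLaw_of_vague h.1 h.2.1 h.2.2⟩

/-- **The crux is EQUIVALENT to D1 ∧ V (registered name): axial pure power law + vague isotropy.**
D1 ⇒ T1 ∧ S2 (`towerLaw_of_axisPowerLaw`, `dilationLaw_of_axisPowerLaw`); r2 ⇒ D1 is the landed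
`axisPowerLaw_of_rotInvPowerLaw`. [cite: DuminilCopinICM2022, §8.1] -/
theorem rotInvPowerLaw_iff_axisPowerLaw_and_vague : Summit.CriticalPhenomena.Ising3DConformalLimit.Theses.IsingEuclidUpgrade.IsingEuclidUpgradeR2RotInvPowerLaw ↔ ((∃ Δ c : ℝ, 0 < c ∧ Filter.Tendsto (fun n : ℕ => Literature.Probability.LatticeModels.criticalTwoPoint 3 (Pi.single 0 ((n : ℕ) : ℤ)) * (n : ℝ) ^ (2 * Δ)) Filter.atTop (nhds c)) ∧ Summit.CriticalPhenomena.Ising3DConformalLimit.Theses.HarmonicMomentsIsotropy.TwoPointAsymptoticIsotropy) :=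
  ⟨fun h => ⟨axisPowerLaw_of_rotInvPowerLaw h, twoPointAsymptoticIsotropy_of_rotInvPowerLaw h⟩,
    fun h => IsingEuclidUpgradeR2RotInvPowerLaw_of_towerLaw_of_dilationLaw_of_vague
      (towerLaw_of_axisPowerLaw h.1) (dilationLaw_of_axisPowerLaw h.1) h.2⟩

/-! ### Corollaries: the crux from mechanism items of other routes -/

/-- **T1 → S2 → HarmonicDilution (6034) → CorrelationLengthWindow (6032) → r2 (registered name)**, through the
landed engine of route HarmonicMomentsIsotropy `twoPointAsymptoticIsotropy_of_harmonicDilution_window`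
(6034 ∧ 6032 ⇒ 6036). [cite: DuminilCopinICM2022, §8.1] -/
theorem IsingEuclidUpgradeR2RotInvPowerLaw_of_towerLaw_of_dilationLaw_of_harmonicDilution_of_window : (∃ Δ c : ℝ, 0 < c ∧ Filter.Tendsto (fun j : ℕ => Literature.Probability.LatticeModels.criticalTwoPoint 3 (Pi.single 0 ((2 ^ j : ℕ) : ℤ)) * ((2 ^ j : ℕ) : ℝ) ^ (2 * Δ)) Filter.atTop (nhds c)) → (∃ Δ : ℝ, ∀ k : ℕ, 1 ≤ k → Filter.Tendsto (fun n : ℕ => Literature.Probability.LatticeModels.criticalTwoPoint 3 (Pi.single 0 ((k * n : ℕ) : ℤ)) * (k : ℝ) ^ (2 * Δ) / Literature.Probability.LatticeModels.criticalTwoPoint 3 (Pi.single 0 ((n : ℕ) : ℤ))) Filter.atTop (nhds 1)) → Summit.CriticalPhenomena.Ising3DConformalLimit.Theses.HarmonicMomentsIsotropy.HarmonicDilution → Summit.CriticalPhenomena.Ising3DConformalLimit.Theses.HarmonicMomentsIsotropy.CorrelationLengthWindow → Summit.CriticalPhenomena.Ising3DConformalLimit.Theses.IsingEuclidUpgrade.IsingEuclidUpgradeR2RotInvPowerLaw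 :=
  fun hT hS2 hHD hCLW => IsingEuclidUpgradeR2RotInvPowerLaw_of_towerLaw_of_dilationLaw_of_vague hT hS2
    (twoPointAsymptoticIsotropy_of_harmonicDilution_window hHD hCLW)

/-- **V ⇒ `AxisToIsotropicLaw` (registered name):** the rank-3 crux of route HelsonAxis (item
stmt-CriticalPhenomena-17971: the axial pure power law propagates to the isotropic cofinite law) FOLLOWS from the
milestone `TwoPointAsymptoticIsotropy` (item 6036). [cite: DuminilCopinICM2022, §8.1] -/
theorem axisToIsotropicLaw_of_vague : Summit.CriticalPhenomena.Ising3DConformalLimit.Theses.HarmonicMomentsIsotropy.TwoPointAsymptoticIsotropy → Summit.CriticalPhenomena.Ising3DConformalLimit.Theses.HelsonAxis.AxisToIsotropicLaw :=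
  fun hV hD1 => IsingEuclidUpgradeR2RotInvPowerLaw_of_towerLaw_of_dilationLaw_of_vague
    (towerLaw_of_axisPowerLaw hD1) (dilationLaw_of_axisPowerLaw hD1) hV

/-- **AxialHelsonCone (18121) → EtaBoundsExist (4662) → V (6036) → r2 (registered name)**, through the Helson
link `axisPowerLaw_of_axialHelsonCone_of_etaBounds`. [cite: DuminilCopinICM2022, §8.1] -/
theorem IsingEuclidUpgradeR2RotInvPowerLaw_of_axialHelsonCone_of_etaBounds_of_vague : Summit.CriticalPhenomena.Ising3DConformalLimit.Theses.HelsonAxis.AxialHelsonCone → Summit.CriticalPhenomena.Ising3DConformalLimit.Theses.HelsonAxis.EtaBoundsExist → Summit.CriticalPhenomena.Ising3DConformalLimit.Theses.HarmonicMomentsIsotropy.TwoPointAsymptoticIsotropy → Summit.CriticalPhenomena.Ising3DConformalLimit.Theses.IsingEuclidUpgrade.IsingEuclidUpgradeR2RotInvPowerLaw :=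
  fun hH hE hV => axisToIsotropicLaw_of_vague hV (axisPowerLaw_of_axialHelsonCone_of_etaBounds hH hE)

end Summit.CriticalPhenomena.Ising3DConformalLimit.Cruxes.IsingEuclidUpgradeR2RotInvPowerLaw.TowerProfileRigidity

end
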